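import Mathlib
import HarnessLib
import Summits.Ventures.LatticeQCDFlow.Exactness.SU2KickCalculus

/-!
# `SU(2)` rung: the pulled-back action `β·S_W∘F − log J` of the LO Wilson-flow member is DIFFERENTIABLE along the drift — the autodiff force through the row's member is a true derivative

HONEST FRAMING: exact (Metropolis-corrected) sampling algorithms for lattice gauge theory;
figures of merit are autocorrelation/cost numbers at stated couplings and volumes; no
continuum-physics claim.

Venture `LatticeQCDFlow` (cell pub-lqcd), topic `Exactness`; FANOUT row 14 (`eng-flowhmc`; the
row's acceptance configuration: FT-HMC through the LO Wilson-flow member on `SU(2)`, forces by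
autodiff of `S̃(exp(c p)·V)`, `S̃ = β S_W∘F − log J`).  NEW WORK of the cell; nothing is cited as a
fact; no number.  The `SU(2)` twin of `U1WilsonFlowLOSmooth`: every exact-force theorem of the cell
is stated with Mathlib's `fderiv` (the derivative where one exists, `0` otherwise);
`SU2ExactForceWilson` settled differentiability for the identity member; here, the LO member itself.
The kick is the matrix exponential `exp((ε/2)(quatVec J·Uᴴ − h.c.))·U` of a differentiable function
of the links (GEN-8's `coe_su2Substep_eq_exp_mul`); the booked density is Lüscher's determinant in
its case-free form `(1 − εj₀)(cos(ε|j⃗|) − εj₀ sinc(ε|j⃗|))²` (GEN-10's `luscherIf_eq_sinc`), whose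
only non-polynomial ingredients `cos(ε√s)`, `sinc(ε√s)` of `s = |j⃗|²` are differentiable ON ALL OF
`ℝ³` — at `j⃗ = 0` they are stationary to second order (`|cos x − 1| ≤ x²/2` — the tree's `SixVertex.abs_cos_sub_one_le` —, `|sinc x − 1| ≤ x²`).

* calculus and linear pieces: `SU2KickCalculus` (`differentiable_cos_sqrt_dotProduct`,
  `differentiable_sinc_sqrt_dotProduct`, `differentiable_luscherSinc`, `su2KickJacFix_eq_luscherSinc`, …);
* link-smooth fields (`p ↦ (U p)_e` differentiable as matrices): `differentiableAt_stapleJ_of_links`,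
  **`linkSmooth_su2WilsonFlowLOSubstep`**, **`differentiableAt_su2WilsonFlowLOJacobian_of_links`**,
  `differentiableAt_wilsonAction_su2_of_links`;
* **`linkSmooth_su2WilsonFlowLO_member`** — induction over ANY schedule packaged as in
  `exists_layers_su2WilsonFlowLO` (formulas VERBATIM): composite link-smooth, running log-det
  differentiable, along every link-smooth field;
* **`differentiableAt_ftAction_su2WilsonFlowLO_drift`** — for positive booked densities,
  `p ↦ β S_W(F(exp(c p)·V)) − log J(exp(c p)·V)` is differentiable at EVERY `p`: the FT-HMC force the
  engine obtains by autodiff through the `SU(2)` LO member is the Fréchet derivative the cell's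
  exact-force theorems (`SU2ExactForceCovariance`, `SU2AcceptanceLatticeExactForce`,
  `SU2AcceptanceLatticeTranslationExactForce`) speak about.

NOT CLAIMED: higher smoothness; the learned residual members (same argument with weights, not
typed); floating point; any number.
-/

noncomputable section

namespace Summit.Ventures.LatticeQCDFlow.Exactness

open WithLp NormedSpace InnerProductGeometry Filter Asymptotics Topology
open Literature.MathematicalPhysics.QuantumFieldTheory Summit.Ventures.LatticeQCDFlow.Scoring
open scoped Matrix Matrix.Norms.Operator

set_option backward.isDefEq.respectTransparency false

/-! ## Link-smooth `SU(2)` fields -/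

section Links

variable {d L : ℕ} {E : Type*} [NormedAddCommGroup E] [NormedSpace ℝ E]

/-- The conjugate-staple field of a link-smooth field is differentiable (`ℝ⁴`-valued). -/
theorem differentiableAt_stapleJ_of_links (U : E → GaugeConfig d L (Matrix.specialUnitaryGroup (Fin 2) ℂ)) (p₀ : E)
    (hU : ∀ e : Edge d L, DifferentiableAt ℝ (fun p : E => ((U p e : (Matrix.specialUnitaryGroup (Fin 2) ℂ)) : Matrix (Fin 2) (Fin 2) ℂ)) p₀) (e : Edge d L) :
    DifferentiableAt ℝ (fun p : E => (∑ ν ∈ Finset.univ.erase e.2,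
            (vecQuat ((((U p) (Site.shift e.1 e.2, ν) * ((U p) (Site.shift e.1 ν, e.2))⁻¹ * ((U p) (e.1, ν))⁻¹)⁻¹ : (Matrix.specialUnitaryGroup (Fin 2) ℂ)) : Matrix (Fin 2) (Fin 2) ℂ) +
              vecQuat (((((U p) (Site.shift (e.1 - Pi.single ν 1) e.2, ν))⁻¹ * ((U p) (e.1 - Pi.single ν 1, e.2))⁻¹ *
                (U p) (e.1 - Pi.single ν 1, ν))⁻¹ : (Matrix.specialUnitaryGroup (Fin 2) ℂ)) : Matrix (Fin 2) (Fin 2) ℂ)))) p₀ := by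
  have hct := differentiable_conjTranspose_two
  simp only [WilsonFlow.coe_mul_SU, WilsonFlow.coe_inv_SU]
  refine DifferentiableAt.fun_sum fun ν _ => ?_
  refine DifferentiableAt.add ?_ ?_
  · exact differentiable_vecQuat.differentiableAt.comp p₀
      (hct.differentiableAt.comp p₀ (((hU _).mul (hct.differentiableAt.comp p₀ (hU _))).mul
        (hct.differentiableAt.comp p₀ (hU _))))
  · exact differentiable_vecQuat.differentiableAt.comp p₀
      (hct.differentiableAt.comp p₀ (((hct.differentiableAt.comp p₀ (hU _)).mul
        (hct.differentiableAt.comp p₀ (hU _))).mul (hU _)))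

/-- **A masked `SU(2)` Wilson-flow sub-step maps link-smooth fields to link-smooth fields** (the kick
is `exp((ε/2)(quatVec J·Uᴴ − h.c.))·U`, GEN-8). -/
theorem linkSmooth_su2WilsonFlowLOSubstep {X : Type*} [DecidableEq X] (χ : Site d L → X)
    (μ : Fin d) (b : X) (ε : ℝ) (U : E → GaugeConfig d L (Matrix.specialUnitaryGroup (Fin 2) ℂ)) (p₀ : E)
    (hU : ∀ e : Edge d L, DifferentiableAt ℝ (fun p : E => ((U p e : (Matrix.specialUnitaryGroup (Fin 2) ℂ)) : Matrix (Fin 2) (Fin 2) ℂ)) p₀) (e : Edge d L) :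
    DifferentiableAt ℝ (fun p : E => (((fun (V : GaugeConfig d L (Matrix.specialUnitaryGroup (Fin 2) ℂ)) (e : Edge d L) =>
        if e.2 = μ ∧ χ e.1 = b then
          gaussUnit (geodesicKick ε (∑ ν ∈ Finset.univ.erase e.2,
            (vecQuat (((V (Site.shift e.1 e.2, ν) * (V (Site.shift e.1 ν, e.2))⁻¹ * (V (e.1, ν))⁻¹)⁻¹ : (Matrix.specialUnitaryGroup (Fin 2) ℂ)) : Matrix (Fin 2) (Fin 2) ℂ) +
              vecQuat ((((V (Site.shift (e.1 - Pi.single ν 1) e.2, ν))⁻¹ * (V (e.1 - Pi.single ν 1, e.2))⁻¹ *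
                V (e.1 - Pi.single ν 1, ν))⁻¹ : (Matrix.specialUnitaryGroup (Fin 2) ℂ)) : Matrix (Fin 2) (Fin 2) ℂ)))
            (vecQuat ((V e : (Matrix.specialUnitaryGroup (Fin 2) ℂ)) : Matrix (Fin 2) (Fin 2) ℂ)))
        else V e) (U p) e : (Matrix.specialUnitaryGroup (Fin 2) ℂ)) : Matrix (Fin 2) (Fin 2) ℂ)) p₀ := by
  by_cases he : e.2 = μ ∧ χ e.1 = b
  · simp only [if_pos he, coe_su2Substep_eq_exp_mul]
    have hJ := differentiableAt_stapleJ_of_links U p₀ hU e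
    have hX : DifferentiableAt ℝ (fun p : E => quatVec (∑ ν ∈ Finset.univ.erase e.2,
            (vecQuat ((((U p) (Site.shift e.1 e.2, ν) * ((U p) (Site.shift e.1 ν, e.2))⁻¹ * ((U p) (e.1, ν))⁻¹)⁻¹ : (Matrix.specialUnitaryGroup (Fin 2) ℂ)) : Matrix (Fin 2) (Fin 2) ℂ) +
              vecQuat (((((U p) (Site.shift (e.1 - Pi.single ν 1) e.2, ν))⁻¹ * ((U p) (e.1 - Pi.single ν 1, e.2))⁻¹ *
                (U p) (e.1 - Pi.single ν 1, ν))⁻¹ : (Matrix.specialUnitaryGroup (Fin 2) ℂ)) : Matrix (Fin 2) (Fin 2) ℂ))) * ((U p e : (Matrix.specialUnitaryGroup (Fin 2) ℂ)) : Matrix (Fin 2) (Fin 2) ℂ)ᴴ) p₀ :=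
      (differentiable_quatVec.differentiableAt.comp p₀ hJ).mul
        (differentiable_conjTranspose_two.differentiableAt.comp p₀ (hU e))
    have hX' : DifferentiableAt ℝ (fun p : E =>
        quatVec (∑ ν ∈ Finset.univ.erase e.2,
            (vecQuat ((((U p) (Site.shift e.1 e.2, ν) * ((U p) (Site.shift e.1 ν, e.2))⁻¹ * ((U p) (e.1, ν))⁻¹)⁻¹ : (Matrix.specialUnitaryGroup (Fin 2) ℂ)) : Matrix (Fin 2) (Fin 2) ℂ) +
              vecQuat (((((U p) (Site.shift (e.1 - Pi.single ν 1) e.2, ν))⁻¹ * ((U p) (e.1 - Pi.single ν 1, e.2))⁻¹ *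
                (U p) (e.1 - Pi.single ν 1, ν))⁻¹ : (Matrix.specialUnitaryGroup (Fin 2) ℂ)) : Matrix (Fin 2) (Fin 2) ℂ))) * ((U p e : (Matrix.specialUnitaryGroup (Fin 2) ℂ)) : Matrix (Fin 2) (Fin 2) ℂ)ᴴ -
          (quatVec (∑ ν ∈ Finset.univ.erase e.2,
            (vecQuat ((((U p) (Site.shift e.1 e.2, ν) * ((U p) (Site.shift e.1 ν, e.2))⁻¹ * ((U p) (e.1, ν))⁻¹)⁻¹ : (Matrix.specialUnitaryGroup (Fin 2) ℂ)) : Matrix (Fin 2) (Fin 2) ℂ) +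
              vecQuat (((((U p) (Site.shift (e.1 - Pi.single ν 1) e.2, ν))⁻¹ * ((U p) (e.1 - Pi.single ν 1, e.2))⁻¹ *
                (U p) (e.1 - Pi.single ν 1, ν))⁻¹ : (Matrix.specialUnitaryGroup (Fin 2) ℂ)) : Matrix (Fin 2) (Fin 2) ℂ))) * ((U p e : (Matrix.specialUnitaryGroup (Fin 2) ℂ)) : Matrix (Fin 2) (Fin 2) ℂ)ᴴ)ᴴ) p₀ :=
      hX.sub (differentiable_conjTranspose_two.differentiableAt.comp p₀ hX)
    have hA : DifferentiableAt ℝ (fun p : E => (((ε / 2 : ℝ)) : ℂ) •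
        (quatVec (∑ ν ∈ Finset.univ.erase e.2,
            (vecQuat ((((U p) (Site.shift e.1 e.2, ν) * ((U p) (Site.shift e.1 ν, e.2))⁻¹ * ((U p) (e.1, ν))⁻¹)⁻¹ : (Matrix.specialUnitaryGroup (Fin 2) ℂ)) : Matrix (Fin 2) (Fin 2) ℂ) +
              vecQuat (((((U p) (Site.shift (e.1 - Pi.single ν 1) e.2, ν))⁻¹ * ((U p) (e.1 - Pi.single ν 1, e.2))⁻¹ *
                (U p) (e.1 - Pi.single ν 1, ν))⁻¹ : (Matrix.specialUnitaryGroup (Fin 2) ℂ)) : Matrix (Fin 2) (Fin 2) ℂ))) * ((U p e : (Matrix.specialUnitaryGroup (Fin 2) ℂ)) : Matrix (Fin 2) (Fin 2) ℂ)ᴴ -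
          (quatVec (∑ ν ∈ Finset.univ.erase e.2,
            (vecQuat ((((U p) (Site.shift e.1 e.2, ν) * ((U p) (Site.shift e.1 ν, e.2))⁻¹ * ((U p) (e.1, ν))⁻¹)⁻¹ : (Matrix.specialUnitaryGroup (Fin 2) ℂ)) : Matrix (Fin 2) (Fin 2) ℂ) +
              vecQuat (((((U p) (Site.shift (e.1 - Pi.single ν 1) e.2, ν))⁻¹ * ((U p) (e.1 - Pi.single ν 1, e.2))⁻¹ *
                (U p) (e.1 - Pi.single ν 1, ν))⁻¹ : (Matrix.specialUnitaryGroup (Fin 2) ℂ)) : Matrix (Fin 2) (Fin 2) ℂ))) * ((U p e : (Matrix.specialUnitaryGroup (Fin 2) ℂ)) : Matrix (Fin 2) (Fin 2) ℂ)ᴴ)ᴴ)) p₀ :=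
      hX'.const_smul (((ε / 2 : ℝ)) : ℂ)
    exact (((contDiffAt_matrixExp _).differentiableAt (by simp)).comp p₀ hA).mul (hU e)
  · simp only [if_neg he]
    exact hU e

variable [NeZero L]

/-- **The booked density of a masked `SU(2)` sub-step along a link-smooth field is differentiable.** -/
theorem differentiableAt_su2WilsonFlowLOJacobian_of_links {X : Type*} [DecidableEq X] (χ : Site d L → X)
    (μ : Fin d) (b : X) (ε : ℝ) (U : E → GaugeConfig d L (Matrix.specialUnitaryGroup (Fin 2) ℂ)) (p₀ : E)
    (hU : ∀ e : Edge d L, DifferentiableAt ℝ (fun p : E => ((U p e : (Matrix.specialUnitaryGroup (Fin 2) ℂ)) : Matrix (Fin 2) (Fin 2) ℂ)) p₀) :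
    DifferentiableAt ℝ (fun p : E => (fun V : GaugeConfig d L (Matrix.specialUnitaryGroup (Fin 2) ℂ) => ∏ a : {e : Edge d L // e.2 = μ ∧ χ e.1 = b},
          (if Real.sin (angle (∑ ν ∈ Finset.univ.erase a.1.2,
            (vecQuat (((V (Site.shift a.1.1 a.1.2, ν) * (V (Site.shift a.1.1 ν, a.1.2))⁻¹ * (V (a.1.1, ν))⁻¹)⁻¹ : (Matrix.specialUnitaryGroup (Fin 2) ℂ)) : Matrix (Fin 2) (Fin 2) ℂ) +
              vecQuat ((((V (Site.shift (a.1.1 - Pi.single ν 1) a.1.2, ν))⁻¹ * (V (a.1.1 - Pi.single ν 1, a.1.2))⁻¹ *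
                V (a.1.1 - Pi.single ν 1, ν))⁻¹ : (Matrix.specialUnitaryGroup (Fin 2) ℂ)) : Matrix (Fin 2) (Fin 2) ℂ))) (vecQuat ((V a.1 : (Matrix.specialUnitaryGroup (Fin 2) ℂ)) : Matrix (Fin 2) (Fin 2) ℂ))) = 0 then
            (1 - ε * ‖(∑ ν ∈ Finset.univ.erase a.1.2,
            (vecQuat (((V (Site.shift a.1.1 a.1.2, ν) * (V (Site.shift a.1.1 ν, a.1.2))⁻¹ * (V (a.1.1, ν))⁻¹)⁻¹ : (Matrix.specialUnitaryGroup (Fin 2) ℂ)) : Matrix (Fin 2) (Fin 2) ℂ) +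
              vecQuat ((((V (Site.shift (a.1.1 - Pi.single ν 1) a.1.2, ν))⁻¹ * (V (a.1.1 - Pi.single ν 1, a.1.2))⁻¹ *
                V (a.1.1 - Pi.single ν 1, ν))⁻¹ : (Matrix.specialUnitaryGroup (Fin 2) ℂ)) : Matrix (Fin 2) (Fin 2) ℂ)))‖ * Real.cos (angle (∑ ν ∈ Finset.univ.erase a.1.2,
            (vecQuat (((V (Site.shift a.1.1 a.1.2, ν) * (V (Site.shift a.1.1 ν, a.1.2))⁻¹ * (V (a.1.1, ν))⁻¹)⁻¹ : (Matrix.specialUnitaryGroup (Fin 2) ℂ)) : Matrix (Fin 2) (Fin 2) ℂ) +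
              vecQuat ((((V (Site.shift (a.1.1 - Pi.single ν 1) a.1.2, ν))⁻¹ * (V (a.1.1 - Pi.single ν 1, a.1.2))⁻¹ *
                V (a.1.1 - Pi.single ν 1, ν))⁻¹ : (Matrix.specialUnitaryGroup (Fin 2) ℂ)) : Matrix (Fin 2) (Fin 2) ℂ))) (vecQuat ((V a.1 : (Matrix.specialUnitaryGroup (Fin 2) ℂ)) : Matrix (Fin 2) (Fin 2) ℂ)))) ^ 3
          else kickJac (ε * ‖(∑ ν ∈ Finset.univ.erase a.1.2,
            (vecQuat (((V (Site.shift a.1.1 a.1.2, ν) * (V (Site.shift a.1.1 ν, a.1.2))⁻¹ * (V (a.1.1, ν))⁻¹)⁻¹ : (Matrix.specialUnitaryGroup (Fin 2) ℂ)) : Matrix (Fin 2) (Fin 2) ℂ) +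
              vecQuat ((((V (Site.shift (a.1.1 - Pi.single ν 1) a.1.2, ν))⁻¹ * (V (a.1.1 - Pi.single ν 1, a.1.2))⁻¹ *
                V (a.1.1 - Pi.single ν 1, ν))⁻¹ : (Matrix.specialUnitaryGroup (Fin 2) ℂ)) : Matrix (Fin 2) (Fin 2) ℂ)))‖) 2 (angle (∑ ν ∈ Finset.univ.erase a.1.2,
            (vecQuat (((V (Site.shift a.1.1 a.1.2, ν) * (V (Site.shift a.1.1 ν, a.1.2))⁻¹ * (V (a.1.1, ν))⁻¹)⁻¹ : (Matrix.specialUnitaryGroup (Fin 2) ℂ)) : Matrix (Fin 2) (Fin 2) ℂ) +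
              vecQuat ((((V (Site.shift (a.1.1 - Pi.single ν 1) a.1.2, ν))⁻¹ * (V (a.1.1 - Pi.single ν 1, a.1.2))⁻¹ *
                V (a.1.1 - Pi.single ν 1, ν))⁻¹ : (Matrix.specialUnitaryGroup (Fin 2) ℂ)) : Matrix (Fin 2) (Fin 2) ℂ))) (vecQuat ((V a.1 : (Matrix.specialUnitaryGroup (Fin 2) ℂ)) : Matrix (Fin 2) (Fin 2) ℂ))))) (U p)) p₀ := by
  classical
  have hd : ∀ a : {e : Edge d L // e.2 = μ ∧ χ e.1 = b}, DifferentiableAt ℝ (fun p : E =>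
      (if Real.sin (angle (∑ ν ∈ Finset.univ.erase a.1.2,
            (vecQuat ((((U p) (Site.shift a.1.1 a.1.2, ν) * ((U p) (Site.shift a.1.1 ν, a.1.2))⁻¹ * ((U p) (a.1.1, ν))⁻¹)⁻¹ : (Matrix.specialUnitaryGroup (Fin 2) ℂ)) : Matrix (Fin 2) (Fin 2) ℂ) +
              vecQuat (((((U p) (Site.shift (a.1.1 - Pi.single ν 1) a.1.2, ν))⁻¹ * ((U p) (a.1.1 - Pi.single ν 1, a.1.2))⁻¹ *
                (U p) (a.1.1 - Pi.single ν 1, ν))⁻¹ : (Matrix.specialUnitaryGroup (Fin 2) ℂ)) : Matrix (Fin 2) (Fin 2) ℂ))) (vecQuat (((U p) a.1 : (Matrix.specialUnitaryGroup (Fin 2) ℂ)) : Matrix (Fin 2) (Fin 2) ℂ))) = 0 then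
            (1 - ε * ‖(∑ ν ∈ Finset.univ.erase a.1.2,
            (vecQuat ((((U p) (Site.shift a.1.1 a.1.2, ν) * ((U p) (Site.shift a.1.1 ν, a.1.2))⁻¹ * ((U p) (a.1.1, ν))⁻¹)⁻¹ : (Matrix.specialUnitaryGroup (Fin 2) ℂ)) : Matrix (Fin 2) (Fin 2) ℂ) +
              vecQuat (((((U p) (Site.shift (a.1.1 - Pi.single ν 1) a.1.2, ν))⁻¹ * ((U p) (a.1.1 - Pi.single ν 1, a.1.2))⁻¹ *
                (U p) (a.1.1 - Pi.single ν 1, ν))⁻¹ : (Matrix.specialUnitaryGroup (Fin 2) ℂ)) : Matrix (Fin 2) (Fin 2) ℂ)))‖ * Real.cos (angle (∑ ν ∈ Finset.univ.erase a.1.2,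
            (vecQuat ((((U p) (Site.shift a.1.1 a.1.2, ν) * ((U p) (Site.shift a.1.1 ν, a.1.2))⁻¹ * ((U p) (a.1.1, ν))⁻¹)⁻¹ : (Matrix.specialUnitaryGroup (Fin 2) ℂ)) : Matrix (Fin 2) (Fin 2) ℂ) +
              vecQuat (((((U p) (Site.shift (a.1.1 - Pi.single ν 1) a.1.2, ν))⁻¹ * ((U p) (a.1.1 - Pi.single ν 1, a.1.2))⁻¹ *
                (U p) (a.1.1 - Pi.single ν 1, ν))⁻¹ : (Matrix.specialUnitaryGroup (Fin 2) ℂ)) : Matrix (Fin 2) (Fin 2) ℂ))) (vecQuat (((U p) a.1 : (Matrix.specialUnitaryGroup (Fin 2) ℂ)) : Matrix (Fin 2) (Fin 2) ℂ)))) ^ 3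
          else kickJac (ε * ‖(∑ ν ∈ Finset.univ.erase a.1.2,
            (vecQuat ((((U p) (Site.shift a.1.1 a.1.2, ν) * ((U p) (Site.shift a.1.1 ν, a.1.2))⁻¹ * ((U p) (a.1.1, ν))⁻¹)⁻¹ : (Matrix.specialUnitaryGroup (Fin 2) ℂ)) : Matrix (Fin 2) (Fin 2) ℂ) +
              vecQuat (((((U p) (Site.shift (a.1.1 - Pi.single ν 1) a.1.2, ν))⁻¹ * ((U p) (a.1.1 - Pi.single ν 1, a.1.2))⁻¹ *
                (U p) (a.1.1 - Pi.single ν 1, ν))⁻¹ : (Matrix.specialUnitaryGroup (Fin 2) ℂ)) : Matrix (Fin 2) (Fin 2) ℂ)))‖) 2 (angle (∑ ν ∈ Finset.univ.erase a.1.2,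
            (vecQuat ((((U p) (Site.shift a.1.1 a.1.2, ν) * ((U p) (Site.shift a.1.1 ν, a.1.2))⁻¹ * ((U p) (a.1.1, ν))⁻¹)⁻¹ : (Matrix.specialUnitaryGroup (Fin 2) ℂ)) : Matrix (Fin 2) (Fin 2) ℂ) +
              vecQuat (((((U p) (Site.shift (a.1.1 - Pi.single ν 1) a.1.2, ν))⁻¹ * ((U p) (a.1.1 - Pi.single ν 1, a.1.2))⁻¹ *
                (U p) (a.1.1 - Pi.single ν 1, ν))⁻¹ : (Matrix.specialUnitaryGroup (Fin 2) ℂ)) : Matrix (Fin 2) (Fin 2) ℂ))) (vecQuat (((U p) a.1 : (Matrix.specialUnitaryGroup (Fin 2) ℂ)) : Matrix (Fin 2) (Fin 2) ℂ))))) p₀ := by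
    intro a
    simp only [su2KickJacFix_eq_luscherSinc]
    have hJ := differentiableAt_stapleJ_of_links U p₀ hU a.1
    have hj : DifferentiableAt ℝ (fun p : E => vecQuat (((U p a.1 : (Matrix.specialUnitaryGroup (Fin 2) ℂ)) : Matrix (Fin 2) (Fin 2) ℂ)ᴴ *
        quatVec (∑ ν ∈ Finset.univ.erase a.1.2,
            (vecQuat ((((U p) (Site.shift a.1.1 a.1.2, ν) * ((U p) (Site.shift a.1.1 ν, a.1.2))⁻¹ * ((U p) (a.1.1, ν))⁻¹)⁻¹ : (Matrix.specialUnitaryGroup (Fin 2) ℂ)) : Matrix (Fin 2) (Fin 2) ℂ) +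
              vecQuat (((((U p) (Site.shift (a.1.1 - Pi.single ν 1) a.1.2, ν))⁻¹ * ((U p) (a.1.1 - Pi.single ν 1, a.1.2))⁻¹ *
                (U p) (a.1.1 - Pi.single ν 1, ν))⁻¹ : (Matrix.specialUnitaryGroup (Fin 2) ℂ)) : Matrix (Fin 2) (Fin 2) ℂ))))) p₀ :=
      differentiable_vecQuat.differentiableAt.comp p₀
        ((differentiable_conjTranspose_two.differentiableAt.comp p₀ (hU a.1)).mul
          (differentiable_quatVec.differentiableAt.comp p₀ hJ))
    exact (differentiable_luscherSinc ε).differentiableAt.comp p₀ hj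
  beta_reduce
  exact (HasFDerivAt.finsetProd (fun a _ => (hd a).hasFDerivAt)).differentiableAt

/-- `β·S_W` (fundamental representation) of a link-smooth `SU(2)` field is differentiable. -/
theorem differentiableAt_wilsonAction_su2_of_links (β : ℝ) (U : E → GaugeConfig d L (Matrix.specialUnitaryGroup (Fin 2) ℂ)) (p₀ : E)
    (hU : ∀ e : Edge d L, DifferentiableAt ℝ (fun p : E => ((U p e : (Matrix.specialUnitaryGroup (Fin 2) ℂ)) : Matrix (Fin 2) (Fin 2) ℂ)) p₀) :
    DifferentiableAt ℝ (fun p : E => β * wilsonAction (Matrix.specialUnitaryGroup (Fin 2) ℂ).subtype (U p)) p₀ := by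
  have hct := differentiable_conjTranspose_two
  let TR : Matrix (Fin 2) (Fin 2) ℂ →ₗ[ℝ] ℝ :=
    { toFun := fun W => (W.trace).re,
      map_add' := fun A B => by simp only [Matrix.trace_add, Complex.add_re],
      map_smul' := fun r A => by
        simp only [Matrix.trace_smul, RingHom.id_apply, Complex.real_smul, Complex.mul_re,
          Complex.ofReal_re, Complex.ofReal_im, zero_mul, sub_zero, smul_eq_mul] }
  have hTR : Differentiable ℝ (fun W : Matrix (Fin 2) (Fin 2) ℂ => (W.trace).re) := (LinearMap.toContinuousLinearMap TR).differentiable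
  have hhol : ∀ (x : Site d L) (μ ν : Fin d), DifferentiableAt ℝ (fun p : E =>
      (((plaquetteHolonomy (U p) x μ ν) : (Matrix.specialUnitaryGroup (Fin 2) ℂ)) : Matrix (Fin 2) (Fin 2) ℂ)) p₀ := by
    intro x μ ν
    simp only [plaquetteHolonomy, WilsonFlow.coe_mul_SU, WilsonFlow.coe_inv_SU]
    exact (((hU _).mul (hU _)).mul (hct.differentiableAt.comp p₀ (hU _))).mul
      (hct.differentiableAt.comp p₀ (hU _))
  unfold wilsonAction
  refine DifferentiableAt.const_mul ?_ β
  refine DifferentiableAt.fun_sum fun pl _ => ?_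
  refine DifferentiableAt.const_sub ?_ _
  simp only [Submonoid.coe_subtype]
  exact (hTR.differentiableAt).comp p₀ (hhol pl.1 pl.2.1.1 pl.2.1.2)

end Links

/-! ## The whole member, by induction over the schedule -/

section Member

variable {d L : ℕ} {X : Type*} [DecidableEq X] (χ : Site d L → X) [NeZero L]
  {E : Type*} [NormedAddCommGroup E] [NormedSpace ℝ E]

/-- **The `SU(2)` LO member maps link-smooth fields to link-smooth fields, with a differentiable
running log-det** — ANY schedule, ANY `layers` packaged as in `exists_layers_su2WilsonFlowLO`. -/
theorem linkSmooth_su2WilsonFlowLO_member (ε : ℝ) (sched : List (Fin d × X)) (layers : List ((GaugeConfig d L (Matrix.specialUnitaryGroup (Fin 2) ℂ) ≃ᵐ GaugeConfig d L (Matrix.specialUnitaryGroup (Fin 2) ℂ)) × (GaugeConfig d L (Matrix.specialUnitaryGroup (Fin 2) ℂ) → ℝ)))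
    (hmap :
      layers.map (fun Ly => ((Ly.1 : GaugeConfig d L (Matrix.specialUnitaryGroup (Fin 2) ℂ) → GaugeConfig d L (Matrix.specialUnitaryGroup (Fin 2) ℂ)), Ly.2)) =
        sched.map (fun s =>
        ((fun (V : GaugeConfig d L (Matrix.specialUnitaryGroup (Fin 2) ℂ)) (e : Edge d L) =>
        if e.2 = s.1 ∧ χ e.1 = s.2 then
          gaussUnit (geodesicKick ε (∑ ν ∈ Finset.univ.erase e.2,
            (vecQuat (((V (Site.shift e.1 e.2, ν) * (V (Site.shift e.1 ν, e.2))⁻¹ * (V (e.1, ν))⁻¹)⁻¹ : (Matrix.specialUnitaryGroup (Fin 2) ℂ)) : Matrix (Fin 2) (Fin 2) ℂ) +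
              vecQuat ((((V (Site.shift (e.1 - Pi.single ν 1) e.2, ν))⁻¹ * (V (e.1 - Pi.single ν 1, e.2))⁻¹ *
                V (e.1 - Pi.single ν 1, ν))⁻¹ : (Matrix.specialUnitaryGroup (Fin 2) ℂ)) : Matrix (Fin 2) (Fin 2) ℂ)))
            (vecQuat ((V e : (Matrix.specialUnitaryGroup (Fin 2) ℂ)) : Matrix (Fin 2) (Fin 2) ℂ)))
        else V e),
         fun V : GaugeConfig d L (Matrix.specialUnitaryGroup (Fin 2) ℂ) => ∏ a : {e : Edge d L // e.2 = s.1 ∧ χ e.1 = s.2},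
          (if Real.sin (angle (∑ ν ∈ Finset.univ.erase a.1.2,
            (vecQuat (((V (Site.shift a.1.1 a.1.2, ν) * (V (Site.shift a.1.1 ν, a.1.2))⁻¹ * (V (a.1.1, ν))⁻¹)⁻¹ : (Matrix.specialUnitaryGroup (Fin 2) ℂ)) : Matrix (Fin 2) (Fin 2) ℂ) +
              vecQuat ((((V (Site.shift (a.1.1 - Pi.single ν 1) a.1.2, ν))⁻¹ * (V (a.1.1 - Pi.single ν 1, a.1.2))⁻¹ *
                V (a.1.1 - Pi.single ν 1, ν))⁻¹ : (Matrix.specialUnitaryGroup (Fin 2) ℂ)) : Matrix (Fin 2) (Fin 2) ℂ))) (vecQuat ((V a.1 : (Matrix.specialUnitaryGroup (Fin 2) ℂ)) : Matrix (Fin 2) (Fin 2) ℂ))) = 0 then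
            (1 - ε * ‖(∑ ν ∈ Finset.univ.erase a.1.2,
            (vecQuat (((V (Site.shift a.1.1 a.1.2, ν) * (V (Site.shift a.1.1 ν, a.1.2))⁻¹ * (V (a.1.1, ν))⁻¹)⁻¹ : (Matrix.specialUnitaryGroup (Fin 2) ℂ)) : Matrix (Fin 2) (Fin 2) ℂ) +
              vecQuat ((((V (Site.shift (a.1.1 - Pi.single ν 1) a.1.2, ν))⁻¹ * (V (a.1.1 - Pi.single ν 1, a.1.2))⁻¹ *
                V (a.1.1 - Pi.single ν 1, ν))⁻¹ : (Matrix.specialUnitaryGroup (Fin 2) ℂ)) : Matrix (Fin 2) (Fin 2) ℂ)))‖ * Real.cos (angle (∑ ν ∈ Finset.univ.erase a.1.2,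
            (vecQuat (((V (Site.shift a.1.1 a.1.2, ν) * (V (Site.shift a.1.1 ν, a.1.2))⁻¹ * (V (a.1.1, ν))⁻¹)⁻¹ : (Matrix.specialUnitaryGroup (Fin 2) ℂ)) : Matrix (Fin 2) (Fin 2) ℂ) +
              vecQuat ((((V (Site.shift (a.1.1 - Pi.single ν 1) a.1.2, ν))⁻¹ * (V (a.1.1 - Pi.single ν 1, a.1.2))⁻¹ *
                V (a.1.1 - Pi.single ν 1, ν))⁻¹ : (Matrix.specialUnitaryGroup (Fin 2) ℂ)) : Matrix (Fin 2) (Fin 2) ℂ))) (vecQuat ((V a.1 : (Matrix.specialUnitaryGroup (Fin 2) ℂ)) : Matrix (Fin 2) (Fin 2) ℂ)))) ^ 3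
          else kickJac (ε * ‖(∑ ν ∈ Finset.univ.erase a.1.2,
            (vecQuat (((V (Site.shift a.1.1 a.1.2, ν) * (V (Site.shift a.1.1 ν, a.1.2))⁻¹ * (V (a.1.1, ν))⁻¹)⁻¹ : (Matrix.specialUnitaryGroup (Fin 2) ℂ)) : Matrix (Fin 2) (Fin 2) ℂ) +
              vecQuat ((((V (Site.shift (a.1.1 - Pi.single ν 1) a.1.2, ν))⁻¹ * (V (a.1.1 - Pi.single ν 1, a.1.2))⁻¹ *
                V (a.1.1 - Pi.single ν 1, ν))⁻¹ : (Matrix.specialUnitaryGroup (Fin 2) ℂ)) : Matrix (Fin 2) (Fin 2) ℂ)))‖) 2 (angle (∑ ν ∈ Finset.univ.erase a.1.2,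
            (vecQuat (((V (Site.shift a.1.1 a.1.2, ν) * (V (Site.shift a.1.1 ν, a.1.2))⁻¹ * (V (a.1.1, ν))⁻¹)⁻¹ : (Matrix.specialUnitaryGroup (Fin 2) ℂ)) : Matrix (Fin 2) (Fin 2) ℂ) +
              vecQuat ((((V (Site.shift (a.1.1 - Pi.single ν 1) a.1.2, ν))⁻¹ * (V (a.1.1 - Pi.single ν 1, a.1.2))⁻¹ *
                V (a.1.1 - Pi.single ν 1, ν))⁻¹ : (Matrix.specialUnitaryGroup (Fin 2) ℂ)) : Matrix (Fin 2) (Fin 2) ℂ))) (vecQuat ((V a.1 : (Matrix.specialUnitaryGroup (Fin 2) ℂ)) : Matrix (Fin 2) (Fin 2) ℂ)))))))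
    (U : E → GaugeConfig d L (Matrix.specialUnitaryGroup (Fin 2) ℂ)) (p₀ : E)
    (hU : ∀ e : Edge d L, DifferentiableAt ℝ (fun p : E => ((U p e : (Matrix.specialUnitaryGroup (Fin 2) ℂ)) : Matrix (Fin 2) (Fin 2) ℂ)) p₀) :
    (∀ e : Edge d L, DifferentiableAt ℝ (fun p : E => (((layers.foldr (fun Ly (F : GaugeConfig d L (Matrix.specialUnitaryGroup (Fin 2) ℂ) ≃ᵐ GaugeConfig d L (Matrix.specialUnitaryGroup (Fin 2) ℂ)) => Ly.1.trans F)
        (MeasurableEquiv.refl (GaugeConfig d L (Matrix.specialUnitaryGroup (Fin 2) ℂ)))) (U p) e : (Matrix.specialUnitaryGroup (Fin 2) ℂ)) : Matrix (Fin 2) (Fin 2) ℂ)) p₀) ∧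
    DifferentiableAt ℝ (fun p : E => (layers.foldr (fun Ly K => fun v => Ly.2 v * K (Ly.1 v)) (fun _ => (1 : ℝ))) (U p)) p₀ := by
  induction sched generalizing layers U with
  | nil =>
    have hnil : layers = [] := by
      have h := congrArg List.length hmap
      simp only [List.length_map, List.length_nil] at h
      exact List.eq_nil_of_length_eq_zero h
    subst hnil
    exact ⟨fun e => hU e, differentiableAt_const _⟩
  | cons s rest ih =>
    obtain ⟨Ly, layers', rfl⟩ : ∃ Ly layers', layers = Ly :: layers' := by
      cases layers with
      | nil => simp at hmap
      | cons Ly layers' => exact ⟨Ly, layers', rfl⟩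
    rw [List.map_cons, List.map_cons, List.cons.injEq] at hmap
    obtain ⟨hLy, hrest⟩ := hmap
    have hF : (Ly.1 : GaugeConfig d L (Matrix.specialUnitaryGroup (Fin 2) ℂ) → GaugeConfig d L (Matrix.specialUnitaryGroup (Fin 2) ℂ)) = (fun (V : GaugeConfig d L (Matrix.specialUnitaryGroup (Fin 2) ℂ)) (e : Edge d L) =>
        if e.2 = s.1 ∧ χ e.1 = s.2 then
          gaussUnit (geodesicKick ε (∑ ν ∈ Finset.univ.erase e.2,
            (vecQuat (((V (Site.shift e.1 e.2, ν) * (V (Site.shift e.1 ν, e.2))⁻¹ * (V (e.1, ν))⁻¹)⁻¹ : (Matrix.specialUnitaryGroup (Fin 2) ℂ)) : Matrix (Fin 2) (Fin 2) ℂ) +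
              vecQuat ((((V (Site.shift (e.1 - Pi.single ν 1) e.2, ν))⁻¹ * (V (e.1 - Pi.single ν 1, e.2))⁻¹ *
                V (e.1 - Pi.single ν 1, ν))⁻¹ : (Matrix.specialUnitaryGroup (Fin 2) ℂ)) : Matrix (Fin 2) (Fin 2) ℂ)))
            (vecQuat ((V e : (Matrix.specialUnitaryGroup (Fin 2) ℂ)) : Matrix (Fin 2) (Fin 2) ℂ)))
        else V e) := (Prod.mk.inj hLy).1
    have hJ : Ly.2 = fun V : GaugeConfig d L (Matrix.specialUnitaryGroup (Fin 2) ℂ) => ∏ a : {e : Edge d L // e.2 = s.1 ∧ χ e.1 = s.2},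
          (if Real.sin (angle (∑ ν ∈ Finset.univ.erase a.1.2,
            (vecQuat (((V (Site.shift a.1.1 a.1.2, ν) * (V (Site.shift a.1.1 ν, a.1.2))⁻¹ * (V (a.1.1, ν))⁻¹)⁻¹ : (Matrix.specialUnitaryGroup (Fin 2) ℂ)) : Matrix (Fin 2) (Fin 2) ℂ) +
              vecQuat ((((V (Site.shift (a.1.1 - Pi.single ν 1) a.1.2, ν))⁻¹ * (V (a.1.1 - Pi.single ν 1, a.1.2))⁻¹ *
                V (a.1.1 - Pi.single ν 1, ν))⁻¹ : (Matrix.specialUnitaryGroup (Fin 2) ℂ)) : Matrix (Fin 2) (Fin 2) ℂ))) (vecQuat ((V a.1 : (Matrix.specialUnitaryGroup (Fin 2) ℂ)) : Matrix (Fin 2) (Fin 2) ℂ))) = 0 then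
            (1 - ε * ‖(∑ ν ∈ Finset.univ.erase a.1.2,
            (vecQuat (((V (Site.shift a.1.1 a.1.2, ν) * (V (Site.shift a.1.1 ν, a.1.2))⁻¹ * (V (a.1.1, ν))⁻¹)⁻¹ : (Matrix.specialUnitaryGroup (Fin 2) ℂ)) : Matrix (Fin 2) (Fin 2) ℂ) +
              vecQuat ((((V (Site.shift (a.1.1 - Pi.single ν 1) a.1.2, ν))⁻¹ * (V (a.1.1 - Pi.single ν 1, a.1.2))⁻¹ *
                V (a.1.1 - Pi.single ν 1, ν))⁻¹ : (Matrix.specialUnitaryGroup (Fin 2) ℂ)) : Matrix (Fin 2) (Fin 2) ℂ)))‖ * Real.cos (angle (∑ ν ∈ Finset.univ.erase a.1.2,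
            (vecQuat (((V (Site.shift a.1.1 a.1.2, ν) * (V (Site.shift a.1.1 ν, a.1.2))⁻¹ * (V (a.1.1, ν))⁻¹)⁻¹ : (Matrix.specialUnitaryGroup (Fin 2) ℂ)) : Matrix (Fin 2) (Fin 2) ℂ) +
              vecQuat ((((V (Site.shift (a.1.1 - Pi.single ν 1) a.1.2, ν))⁻¹ * (V (a.1.1 - Pi.single ν 1, a.1.2))⁻¹ *
                V (a.1.1 - Pi.single ν 1, ν))⁻¹ : (Matrix.specialUnitaryGroup (Fin 2) ℂ)) : Matrix (Fin 2) (Fin 2) ℂ))) (vecQuat ((V a.1 : (Matrix.specialUnitaryGroup (Fin 2) ℂ)) : Matrix (Fin 2) (Fin 2) ℂ)))) ^ 3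
          else kickJac (ε * ‖(∑ ν ∈ Finset.univ.erase a.1.2,
            (vecQuat (((V (Site.shift a.1.1 a.1.2, ν) * (V (Site.shift a.1.1 ν, a.1.2))⁻¹ * (V (a.1.1, ν))⁻¹)⁻¹ : (Matrix.specialUnitaryGroup (Fin 2) ℂ)) : Matrix (Fin 2) (Fin 2) ℂ) +
              vecQuat ((((V (Site.shift (a.1.1 - Pi.single ν 1) a.1.2, ν))⁻¹ * (V (a.1.1 - Pi.single ν 1, a.1.2))⁻¹ *
                V (a.1.1 - Pi.single ν 1, ν))⁻¹ : (Matrix.specialUnitaryGroup (Fin 2) ℂ)) : Matrix (Fin 2) (Fin 2) ℂ)))‖) 2 (angle (∑ ν ∈ Finset.univ.erase a.1.2,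
            (vecQuat (((V (Site.shift a.1.1 a.1.2, ν) * (V (Site.shift a.1.1 ν, a.1.2))⁻¹ * (V (a.1.1, ν))⁻¹)⁻¹ : (Matrix.specialUnitaryGroup (Fin 2) ℂ)) : Matrix (Fin 2) (Fin 2) ℂ) +
              vecQuat ((((V (Site.shift (a.1.1 - Pi.single ν 1) a.1.2, ν))⁻¹ * (V (a.1.1 - Pi.single ν 1, a.1.2))⁻¹ *
                V (a.1.1 - Pi.single ν 1, ν))⁻¹ : (Matrix.specialUnitaryGroup (Fin 2) ℂ)) : Matrix (Fin 2) (Fin 2) ℂ))) (vecQuat ((V a.1 : (Matrix.specialUnitaryGroup (Fin 2) ℂ)) : Matrix (Fin 2) (Fin 2) ℂ)))) := (Prod.mk.inj hLy).2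
    have hU' : ∀ e : Edge d L, DifferentiableAt ℝ (fun p : E => ((Ly.1 (U p) e : (Matrix.specialUnitaryGroup (Fin 2) ℂ)) : Matrix (Fin 2) (Fin 2) ℂ)) p₀ := by
      intro e
      rw [hF]
      exact linkSmooth_su2WilsonFlowLOSubstep χ s.1 s.2 ε U p₀ hU e
    obtain ⟨ihF, ihJ⟩ := ih layers' hrest (fun p => Ly.1 (U p)) hU'
    refine ⟨fun e => ?_, ?_⟩
    · simp only [List.foldr_cons, MeasurableEquiv.coe_trans, Function.comp_apply]
      exact ihF e
    · simp only [List.foldr_cons]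
      have hJ' : DifferentiableAt ℝ (fun p : E => Ly.2 (U p)) p₀ := by
        rw [hJ]
        exact differentiableAt_su2WilsonFlowLOJacobian_of_links χ s.1 s.2 ε U p₀ hU
      exact hJ'.mul ihJ

/-- **The pulled-back action of the `SU(2)` LO member is differentiable along the drift, at every
momentum** (positive booked densities, `S = β·S_W`): the autodiff force through the member is a true
derivative. -/
theorem differentiableAt_ftAction_su2WilsonFlowLO_drift (ε : ℝ) (sched : List (Fin d × X)) (layers : List ((GaugeConfig d L (Matrix.specialUnitaryGroup (Fin 2) ℂ) ≃ᵐ GaugeConfig d L (Matrix.specialUnitaryGroup (Fin 2) ℂ)) × (GaugeConfig d L (Matrix.specialUnitaryGroup (Fin 2) ℂ) → ℝ)))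
    (hmap :
      layers.map (fun Ly => ((Ly.1 : GaugeConfig d L (Matrix.specialUnitaryGroup (Fin 2) ℂ) → GaugeConfig d L (Matrix.specialUnitaryGroup (Fin 2) ℂ)), Ly.2)) =
        sched.map (fun s =>
        ((fun (V : GaugeConfig d L (Matrix.specialUnitaryGroup (Fin 2) ℂ)) (e : Edge d L) =>
        if e.2 = s.1 ∧ χ e.1 = s.2 then
          gaussUnit (geodesicKick ε (∑ ν ∈ Finset.univ.erase e.2,
            (vecQuat (((V (Site.shift e.1 e.2, ν) * (V (Site.shift e.1 ν, e.2))⁻¹ * (V (e.1, ν))⁻¹)⁻¹ : (Matrix.specialUnitaryGroup (Fin 2) ℂ)) : Matrix (Fin 2) (Fin 2) ℂ) +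
              vecQuat ((((V (Site.shift (e.1 - Pi.single ν 1) e.2, ν))⁻¹ * (V (e.1 - Pi.single ν 1, e.2))⁻¹ *
                V (e.1 - Pi.single ν 1, ν))⁻¹ : (Matrix.specialUnitaryGroup (Fin 2) ℂ)) : Matrix (Fin 2) (Fin 2) ℂ)))
            (vecQuat ((V e : (Matrix.specialUnitaryGroup (Fin 2) ℂ)) : Matrix (Fin 2) (Fin 2) ℂ)))
        else V e),
         fun V : GaugeConfig d L (Matrix.specialUnitaryGroup (Fin 2) ℂ) => ∏ a : {e : Edge d L // e.2 = s.1 ∧ χ e.1 = s.2},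
          (if Real.sin (angle (∑ ν ∈ Finset.univ.erase a.1.2,
            (vecQuat (((V (Site.shift a.1.1 a.1.2, ν) * (V (Site.shift a.1.1 ν, a.1.2))⁻¹ * (V (a.1.1, ν))⁻¹)⁻¹ : (Matrix.specialUnitaryGroup (Fin 2) ℂ)) : Matrix (Fin 2) (Fin 2) ℂ) +
              vecQuat ((((V (Site.shift (a.1.1 - Pi.single ν 1) a.1.2, ν))⁻¹ * (V (a.1.1 - Pi.single ν 1, a.1.2))⁻¹ *
                V (a.1.1 - Pi.single ν 1, ν))⁻¹ : (Matrix.specialUnitaryGroup (Fin 2) ℂ)) : Matrix (Fin 2) (Fin 2) ℂ))) (vecQuat ((V a.1 : (Matrix.specialUnitaryGroup (Fin 2) ℂ)) : Matrix (Fin 2) (Fin 2) ℂ))) = 0 then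
            (1 - ε * ‖(∑ ν ∈ Finset.univ.erase a.1.2,
            (vecQuat (((V (Site.shift a.1.1 a.1.2, ν) * (V (Site.shift a.1.1 ν, a.1.2))⁻¹ * (V (a.1.1, ν))⁻¹)⁻¹ : (Matrix.specialUnitaryGroup (Fin 2) ℂ)) : Matrix (Fin 2) (Fin 2) ℂ) +
              vecQuat ((((V (Site.shift (a.1.1 - Pi.single ν 1) a.1.2, ν))⁻¹ * (V (a.1.1 - Pi.single ν 1, a.1.2))⁻¹ *
                V (a.1.1 - Pi.single ν 1, ν))⁻¹ : (Matrix.specialUnitaryGroup (Fin 2) ℂ)) : Matrix (Fin 2) (Fin 2) ℂ)))‖ * Real.cos (angle (∑ ν ∈ Finset.univ.erase a.1.2,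
            (vecQuat (((V (Site.shift a.1.1 a.1.2, ν) * (V (Site.shift a.1.1 ν, a.1.2))⁻¹ * (V (a.1.1, ν))⁻¹)⁻¹ : (Matrix.specialUnitaryGroup (Fin 2) ℂ)) : Matrix (Fin 2) (Fin 2) ℂ) +
              vecQuat ((((V (Site.shift (a.1.1 - Pi.single ν 1) a.1.2, ν))⁻¹ * (V (a.1.1 - Pi.single ν 1, a.1.2))⁻¹ *
                V (a.1.1 - Pi.single ν 1, ν))⁻¹ : (Matrix.specialUnitaryGroup (Fin 2) ℂ)) : Matrix (Fin 2) (Fin 2) ℂ))) (vecQuat ((V a.1 : (Matrix.specialUnitaryGroup (Fin 2) ℂ)) : Matrix (Fin 2) (Fin 2) ℂ)))) ^ 3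
          else kickJac (ε * ‖(∑ ν ∈ Finset.univ.erase a.1.2,
            (vecQuat (((V (Site.shift a.1.1 a.1.2, ν) * (V (Site.shift a.1.1 ν, a.1.2))⁻¹ * (V (a.1.1, ν))⁻¹)⁻¹ : (Matrix.specialUnitaryGroup (Fin 2) ℂ)) : Matrix (Fin 2) (Fin 2) ℂ) +
              vecQuat ((((V (Site.shift (a.1.1 - Pi.single ν 1) a.1.2, ν))⁻¹ * (V (a.1.1 - Pi.single ν 1, a.1.2))⁻¹ *
                V (a.1.1 - Pi.single ν 1, ν))⁻¹ : (Matrix.specialUnitaryGroup (Fin 2) ℂ)) : Matrix (Fin 2) (Fin 2) ℂ)))‖) 2 (angle (∑ ν ∈ Finset.univ.erase a.1.2,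
            (vecQuat (((V (Site.shift a.1.1 a.1.2, ν) * (V (Site.shift a.1.1 ν, a.1.2))⁻¹ * (V (a.1.1, ν))⁻¹)⁻¹ : (Matrix.specialUnitaryGroup (Fin 2) ℂ)) : Matrix (Fin 2) (Fin 2) ℂ) +
              vecQuat ((((V (Site.shift (a.1.1 - Pi.single ν 1) a.1.2, ν))⁻¹ * (V (a.1.1 - Pi.single ν 1, a.1.2))⁻¹ *
                V (a.1.1 - Pi.single ν 1, ν))⁻¹ : (Matrix.specialUnitaryGroup (Fin 2) ℂ)) : Matrix (Fin 2) (Fin 2) ℂ))) (vecQuat ((V a.1 : (Matrix.specialUnitaryGroup (Fin 2) ℂ)) : Matrix (Fin 2) (Fin 2) ℂ)))))))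
    (hpos : ∀ Ly ∈ layers, ∀ V, 0 < Ly.2 V) (β c : ℝ) (V : GaugeConfig d L (Matrix.specialUnitaryGroup (Fin 2) ℂ)) (p₀ : ((Edge d L × Fin 3) → ℝ)) :
    DifferentiableAt ℝ (fun p : ((Edge d L × Fin 3) → ℝ) =>
      (fun W : GaugeConfig d L (Matrix.specialUnitaryGroup (Fin 2) ℂ) => β * wilsonAction (Matrix.specialUnitaryGroup (Fin 2) ℂ).subtype ((layers.foldr (fun Ly (F : GaugeConfig d L (Matrix.specialUnitaryGroup (Fin 2) ℂ) ≃ᵐ GaugeConfig d L (Matrix.specialUnitaryGroup (Fin 2) ℂ)) => Ly.1.trans F)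
        (MeasurableEquiv.refl (GaugeConfig d L (Matrix.specialUnitaryGroup (Fin 2) ℂ)))) W) - Real.log ((layers.foldr (fun Ly K => fun v => Ly.2 v * K (Ly.1 v)) (fun _ => (1 : ℝ))) W)) ((fun ℓ : Edge d L => gaussUnit (toLp 2
          ![Real.cos (c * Real.sqrt (p (ℓ, 0) ^ 2 + p (ℓ, 1) ^ 2 + p (ℓ, 2) ^ 2)),
            c * Real.sinc (c * Real.sqrt (p (ℓ, 0) ^ 2 + p (ℓ, 1) ^ 2 + p (ℓ, 2) ^ 2)) * p (ℓ, 0),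
            c * Real.sinc (c * Real.sqrt (p (ℓ, 0) ^ 2 + p (ℓ, 1) ^ 2 + p (ℓ, 2) ^ 2)) * p (ℓ, 1),
            c * Real.sinc (c * Real.sqrt (p (ℓ, 0) ^ 2 + p (ℓ, 1) ^ 2 + p (ℓ, 2) ^ 2)) * p (ℓ, 2)])) * V)) p₀ := by
  have hU : ∀ e : Edge d L, DifferentiableAt ℝ (fun p : ((Edge d L × Fin 3) → ℝ) => ((((fun ℓ : Edge d L => gaussUnit (toLp 2
          ![Real.cos (c * Real.sqrt (p (ℓ, 0) ^ 2 + p (ℓ, 1) ^ 2 + p (ℓ, 2) ^ 2)),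
            c * Real.sinc (c * Real.sqrt (p (ℓ, 0) ^ 2 + p (ℓ, 1) ^ 2 + p (ℓ, 2) ^ 2)) * p (ℓ, 0),
            c * Real.sinc (c * Real.sqrt (p (ℓ, 0) ^ 2 + p (ℓ, 1) ^ 2 + p (ℓ, 2) ^ 2)) * p (ℓ, 1),
            c * Real.sinc (c * Real.sqrt (p (ℓ, 0) ^ 2 + p (ℓ, 1) ^ 2 + p (ℓ, 2) ^ 2)) * p (ℓ, 2)])) * V) e : (Matrix.specialUnitaryGroup (Fin 2) ℂ)) : Matrix (Fin 2) (Fin 2) ℂ)) p₀ :=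
    fun e => differentiableAt_su2Drift_link c V e p₀
  obtain ⟨hF, hJ⟩ := linkSmooth_su2WilsonFlowLO_member χ ε sched layers hmap (fun p : ((Edge d L × Fin 3) → ℝ) => (fun ℓ : Edge d L => gaussUnit (toLp 2
          ![Real.cos (c * Real.sqrt (p (ℓ, 0) ^ 2 + p (ℓ, 1) ^ 2 + p (ℓ, 2) ^ 2)),
            c * Real.sinc (c * Real.sqrt (p (ℓ, 0) ^ 2 + p (ℓ, 1) ^ 2 + p (ℓ, 2) ^ 2)) * p (ℓ, 0),
            c * Real.sinc (c * Real.sqrt (p (ℓ, 0) ^ 2 + p (ℓ, 1) ^ 2 + p (ℓ, 2) ^ 2)) * p (ℓ, 1),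
            c * Real.sinc (c * Real.sqrt (p (ℓ, 0) ^ 2 + p (ℓ, 1) ^ 2 + p (ℓ, 2) ^ 2)) * p (ℓ, 2)])) * V) p₀ hU
  beta_reduce
  refine (differentiableAt_wilsonAction_su2_of_links β _ p₀ hF).sub ?_
  exact hJ.log (foldr_logDet_pos layers hpos _).ne'

end Member

end Summit.Ventures.LatticeQCDFlow.Exactness
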